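import Mathlib
import Summits.QuantumAdvantage.QuantumAdvantage.Theorems.MobiusLadderDigitPolyUniformityMRTAlignedWide
import HarnessLib

/-!
# Crux `DigitPolyUniformity` (stmt-QuantumAdvantage-1392), line `Sketch`, cycle 7 — Stub KMT-B
# (aligned plain blocks of `λ`, real form, every depth)

The `α = 0` specialisation, in real form, of the tree's PROVED wide aligned Matomäki–Radziwiłł–Tao bound
`stub_alignedMRT_wide` (`Theorems/…MRTAlignedWide`): for every `ε > 0` there is `h₀` such that, eventually
in `n`, for every depth `h` with `h₀ ≤ h ≤ n − h₀`,
`Σ_{y < 2^{n−h}} |Σ_{N ∈ [2^h y, 2^h y + 2^h)} λ(N)| ≤ ε 2ⁿ`.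
With `α = 0` the phase is `e(0 · N) = e(0) = 1`, the complex block sum is the cast of the real one, and
`Σ_{x < 2^h} f(2^h y + x) = Σ_{N ∈ Ico (2^h y) (2^h y + 2^h)} f(N)` (`Finset.sum_Ico_eq_sum_range`).
-/

noncomputable section

namespace Summit.QuantumAdvantage.DigitPolyUniformity.SketchLAR.KMT

open Filter Finset

/-- At `α = 0` the norm of the complex twisted block sum `Σ_{x < 2^h} λ(2^h y + x) e(0 · (2^h y + x))` is the
absolute value of the real plain block sum `Σ_{N ∈ Ico (2^h y) (2^h y + 2^h)} λ(N)`. [folklore] -/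
theorem norm_blockSum_twist_zero (h y : ℕ) :
    ‖∑ x ∈ range (2 ^ h), ((ArithmeticFunction.liouville (2 ^ h * y + x) : ℤ) : ℂ) *
        Literature.NumberTheory.LFunctions.VdC.e (0 * ((2 ^ h * y + x : ℕ) : ℝ))‖ =
      |∑ N ∈ Ico (2 ^ h * y) (2 ^ h * y + 2 ^ h), ((ArithmeticFunction.liouville N : ℤ) : ℝ)| := by
  simp only [zero_mul, Literature.NumberTheory.LFunctions.VdC.e_zero, mul_one]
  rw [Finset.sum_Ico_eq_sum_range, Nat.add_sub_cancel_left, ← Real.norm_eq_abs, ← Complex.norm_real,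
    Complex.ofReal_sum]
  simp only [Complex.ofReal_intCast]

/-- **Stub KMT-B (aligned plain blocks, real form, every depth).** From the tree's PROVED `stub_alignedMRT_wide`
(Matomäki–Radziwiłł–Tao on aligned dyadic blocks at all scales `2^{h₀} ≤ 2^h ≤ 2ⁿ/2^{h₀}`) at `α = 0`: for every
`ε > 0` there is `h₀` with, eventually in `n`, for all `h₀ ≤ h ≤ n − h₀`:
`Σ_{y<2^{n−h}} |Σ_{N ∈ [2^h y, 2^h y + 2^h)} λ(N)| ≤ ε2ⁿ`. [cite: MatomakiRadziwillTao2015, Theorem 1.3] -/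
theorem stub_kmt_alignedBlocks_real :
    ∀ ε : ℝ, 0 < ε → ∃ h₀ : ℕ, ∀ᶠ n : ℕ in atTop, ∀ h : ℕ, h₀ ≤ h → h + h₀ ≤ n →
      ∑ y ∈ range (2 ^ (n - h)),
        |∑ N ∈ Ico (2 ^ h * y) (2 ^ h * y + 2 ^ h), ((ArithmeticFunction.liouville N : ℤ) : ℝ)| ≤ ε * 2 ^ n := by
  intro ε hε
  obtain ⟨h₀, H⟩ := stub_alignedMRT_wide ε hε
  refine ⟨h₀, ?_⟩
  filter_upwards [H] with n hn h h1 h2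
  have key := hn h h1 h2 0
  simpa only [norm_blockSum_twist_zero] using key

end Summit.QuantumAdvantage.DigitPolyUniformity.SketchLAR.KMT

end
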